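import Literature.AlgebraicGeometry.ComplexMultiplication.CyclotomicFermatCMTypesOddTwoPrimeLevelExceptional
import HarnessLib

/-!
# Koblitz–Rohrlich, Theorem 1 (i) in its printed form «`{r,s,t} ∼ {r′,s′,t′}`» and Theorem 1 (ii) «the only isogenies are the obvious
# equalities» at the exceptional levels `N = 21, 39` — hence at EVERY odd two-prime level; Remark 2's «we can take `(r, s, t)` to be `(1, ρ, ρ²)`»

Layer `Literature/AlgebraicGeometry/ComplexMultiplication`, namespace `…ComplexMultiplication.CyclotomicFermatCMType`; sequel of
`CyclotomicFermatCMTypesOddTwoPrimeLevelExceptional` (at `21`, `39` the tree's STRONG form of (∗) — `H_{τ′} = H_τ ⟹ {τ′} = {τ}` for unit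
triples — fails) and `CyclotomicFermatCMTypesOddTwoPrimeLevelSimple` ((∗) and Theorems 1–2 at every odd two-prime level `N ∉ {21, 39}`).
THEOREMS ONLY (no definition, no named fact, no `sorry`); the level-`21`/`39` statements are kernel computations (`decide`) over all unit
triples, the rest is the glue printed in §1 of the source.

THE SOURCE.  N. Koblitz, D. Rohrlich, *Simple factors in the Jacobian of a Fermat curve*, Canad. J. Math. **30** (1978) 1183–1205.
§1 (p. 1184): "if g.c.d. `(r, N) = 1`, we may assume that the pair is actually `(1, s)`"; "If … `H_{r,s} = hH_{r′,s′}` for some `h` in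
`(ℤ/Nℤ)*`, then `L_{r,s}` and `L_{r′,s′}` are identical lattices.  On the other hand, suppose `L_{r,s}` and `L_{r′,s′}` are isogenous. Then
… `hH_{r,s} = H_{r′,s′}` for some `h` in `(ℤ/Nℤ)*`."  P. 1185: "Thus it is natural to define an equivalence `{r, s, t} ∼ {r′, s′, t′}` if and
only if there exists `h ∈ (ℤ/Nℤ)*` such that, up to a permutation, we have `{r′, s′, t′} = {⟨hr⟩, ⟨hs⟩, ⟨ht⟩}`. … The equality of lattices
`L_{r,s,t}` resulting from an equivalence of triples will be called an obvious equality, or obvious isogeny.  THEOREM 1. Suppose `N` is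
prime to `6`. Then: (i) `H_{r,s,t} = H_{r′,s′,t′}` if and only if `{r, s, t} ∼ {r′, s′, t′}`. (ii) The only isogenies between the lattices
`L_{r,s,t}` are the obvious equalities.  It is clear that (ii) follows from (i)."  §2 (p. 1187) proves, for `N` prime to `6` in the
relatively prime case, the STRONGER "if `H_{r,s,t} = H_{r′,s′,t′}` then `{r, s, t} = {r′, s′, t′}`", and REMARK 2 (p. 1193): "If `N` is odd
and `3|N` … `s(21) = 1/6`, `s(39) = 1/4`.  For all other values of `N`, it thus follows that there can be no non-obvious isogenies between
`J_{r,s,t}` and `J_{r′,s′,t′}` if `r, s, t, r′, s′, t′` are all prime to `N`. … When `N = 21, 39`, the non-obvious isogenies in the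
relatively prime case all turn out to occur when `J_{r,s,t}` is isogenous to a product of elliptic curves.  In each case we can take
`(r, s, t)` to be `(1, ρ, ρ²)` where `ρ` is a cube root of `1 mod N`."

WHAT IS PROVED.

* §1 (any level `N`, the glue of K–R §1): from the normalised triples `(1, s, −1−s)` to arbitrary unit triples
  (`exists_unit_multiset_eq_of_fermatCMType_eq_of_normalised`); **"(ii) follows from (i)"**: if at level `N` every coincidence
  `H_{τ′} = H_τ` of unit triples is an equivalence `τ′ ∼ τ`, then (a) `H_{τ′}` is a unit translate `{x | ux ∈ H_τ}` iff `τ′ ∼ τ`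
  (`exists_forall_mem_iff_iff_exists_unit_multiset_eq_of_classForm`) and (b) abelian varieties of types `Φ_{H_τ}`, `Φ_{H_{τ′}}` of `ℚ(ζ_N)` are
  ISOGENOUS iff `τ′ ∼ τ` (`isIsogenous_fermatCMType_iff_exists_unit_multiset_eq_of_classForm`, through the tree's any-level
  `isIsogenous_fermatCMType_iff_exists_unit_translate`).
* §2 `N = 21` (kernel enumeration of all unit triples): **Theorem 1 (i) in the printed `∼` form HOLDS at `21`** — `H_{τ′} = H_τ ⟹ τ′ ∼ τ`
  (`exists_unit_multiset_eq_of_fermatCMType_eq_twentyOne`), although the strong form fails (sibling); **Remark 2**: a NON-obvious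
  coincidence `H_{τ′} = H_τ`, `{τ′} ≠ {τ}`, forces `τ ∼ (1, 4, 16) = (1, ρ, ρ²)` (`exists_unit_multiset_eq_cubeRoots_of_fermatCMType_eq_of_ne_twentyOne`;
  the cube roots of `1 mod 21` are `1, 4, 16`: `pow_three_eq_one_iff_twentyOne`); **Theorem 1 (ii) at `21`**: abelian varieties of types
  `Φ_{H_τ}`, `Φ_{H_{τ′}}` of `ℚ(ζ₂₁)` (unit triples) are isogenous iff `τ′ ∼ τ` (`isIsogenous_fermatCMType_iff_exists_unit_multiset_eq_twentyOne`).
* §3 `N = 39`: the same with `(1, ρ, ρ²) = (1, 16, 22)`.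
* §4 **EVERY ODD TWO-PRIME LEVEL `N = pᵃqᵇ`** (`p ≠ q` odd primes, `a, b ≥ 1`, NO exception): Theorem 1 (i) in the `∼` form
  (`exists_unit_multiset_eq_of_fermatCMType_eq_oddTwoPrimeLevel`) and **Theorem 1 (ii)**
  (`isIsogenous_fermatCMType_iff_exists_unit_multiset_eq_oddTwoPrimeLevel`) — the sibling's `…_oddTwoPrimes` versions minus the hypotheses
  `N ≠ 21`, `N ≠ 39`.

## Honest column / NOT here

* K–R state Theorem 1 for `N` prime to `6`; the statements at `21`, `39` and §4 are OURS (enumeration + K–R's own §1 glue), consistent with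
  Remark 2: the relations `H_{2,8,11} = H_{1,4,16}` etc. that break the strong form are equivalences `τ′ = 2τ ∼ τ`, and Remark 2's
  isogenies `J_{1,4,16} ∼ E⁶`, `J_{1,16,22} ∼ E¹²` are with powers of LOWER-dimensional factors (not typed here, see the sibling's honest
  column) — between two abelian varieties of the full types `Φ_{H_τ}`, `Φ_{H_{τ′}}` (dimension `φ(N)/2`, unit triples) every isogeny is
  obvious at `21` and `39` too.
* Relatively prime case only (all six residues units); the boundary cases (K–R §3: "there are non-obvious isogenies in the boundary cases if
  `3|N`") are NOT typed.  Levels `3ᵃ∏qᵢ^{bᵢ}` with two or more primes `qᵢ ≥ 5` are NOT typed (Remark 2 beyond two primes).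
* As in the siblings, "isogeny of lattices `L_{r,s,t}`" is typed as isogeny of abelian varieties realising the CM types `Φ_{H_{r,s,t}}` of
  `ℚ(ζ_N)` (Shimura–Taniyama through the tree's `isIsogenous_fermatCMType_iff_exists_unit_translate`); the Jacobian factors `J_{r,s,t}`
  themselves are not constructed.
* Kernel `decide` only (no `native_decide`); the level-`39` enumerations need `maxRecDepth 100000`.  Private: `map_mul_triple`,
  `isUnit_iff_val_coprime₉`, `exists_unit_multiset_eq_pair_of_normalised`.

## References

* [KoblitzRohrlich1978] N. Koblitz, D. Rohrlich, Canad. J. Math. 30 (1978) 1183–1205: §1 (pp. 1184–1185), Theorem 1 (p. 1185), §2 (p. 1187),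
  Remark 2 (p. 1193).
* [Shimura1998] G. Shimura, *Abelian Varieties with Complex Multiplication and Modular Functions*, §6.1 Corollary, §8.4 Example (1)
  (through `CyclotomicCMTypeIsogenyClasses`).

## Provenance

Cell `pub-hodgecm2` (COR-CM), literature seat `lit-deligne-3` gen 35 (claim KR78-CLASSFORM; count-neutral, own lane).
-/

noncomputable section

open NumberField

namespace Literature.AlgebraicGeometry.ComplexMultiplication

open Literature.NumberTheory.ComplexMultiplication
open Literature.NumberTheory.LFunctions
open Literature.AlgebraicGeometry.HodgeTheory
open Literature.AlgebraicGeometry.Pohlmann1968 Literature.AlgebraicGeometry.Pohlmann1968.Cyclotomic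

namespace CyclotomicFermatCMType

/-! ## §1 Any level: normalisation `(r, s, t) = r·(1, s₁, t₁)` and "(ii) follows from (i)" -/

section AnyLevel

open CategoryTheory
open Literature.AlgebraicGeometry.Motives (AbelianVariety)
open CyclotomicCMTypeResidueSets (IsCMResidueSet)

variable {N : ℕ} [NeZero N]

/-- The image of a triple under multiplication by `c`. [folklore] -/
private theorem map_mul_triple {α : Type*} [Mul α] (c x y z : α) :
    (({x, y, z} : Multiset α).map (fun w => c * w)) = {c * x, c * y, c * z} := by
  simp only [Multiset.insert_eq_cons, Multiset.map_cons, Multiset.map_singleton]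

/-- Units of `ℤ/N` are the residues with value prime to `N` (private copy of the siblings'). [folklore] -/
private theorem isUnit_iff_val_coprime₉ (x : ZMod N) : IsUnit x ↔ x.val.Coprime N := by
  conv_lhs => rw [← ZMod.natCast_zmod_val x]
  exact ZMod.isUnit_iff_coprime x.val N

/-- **From normalised triples to all unit triples** ("if g.c.d. `(r, N) = 1`, we may assume that the pair is actually `(1, s)`"): if at
level `N` every coincidence `H_{r′,s′,−r′−s′} = H_{1,s,−1−s}` among unit triples yields `{r′, s′, −r′−s′} = u·{1, s, −1−s}` for some `u`, then
for arbitrary unit triples `τ = (r,s,t)`, `τ′ = (r′,s′,t′)` (sums `0`) `H_{τ′} = H_τ` implies `{r′,s′,t′} = {ur, us, ut}` for a UNIT `u`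
(`τ′ ∼ τ` in the sense of p. 1185). [cite: KoblitzRohrlich1978, §1 (pp. 1184–1185)] -/
theorem exists_unit_multiset_eq_of_fermatCMType_eq_of_normalised
    (H : ∀ s r' s' : ZMod N, s.val.Coprime N → (-1 - s : ZMod N).val.Coprime N →
      r'.val.Coprime N → s'.val.Coprime N → (-r' - s' : ZMod N).val.Coprime N →
      fermatCMType N r' s' (-r' - s') = fermatCMType N 1 s (-1 - s) →
      ∃ u : ZMod N, ({r', s', -r' - s'} : Multiset (ZMod N)) = {u, u * s, u * (-1 - s)})
    {r s t r' s' t' : ZMod N} (hr : IsUnit r) (hs : IsUnit s) (ht : IsUnit t) (hrst : r + s + t = 0)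
    (hr' : IsUnit r') (hs' : IsUnit s') (ht' : IsUnit t') (hrst' : r' + s' + t' = 0)
    (heq : fermatCMType N r' s' t' = fermatCMType N r s t) :
    ∃ u : ZMod N, IsUnit u ∧ ({r', s', t'} : Multiset (ZMod N)) = {u * r, u * s, u * t} := by
  obtain rfl : t = -r - s := by linear_combination hrst
  obtain rfl : t' = -r' - s' := by linear_combination hrst'
  obtain ⟨ri, hri⟩ := hr.exists_right_inv
  have hri' : IsUnit ri := IsUnit.of_mul_eq_one_right r hri
  have e₁ : ri * (-r - s) = -1 - ri * s := by linear_combination (-1 : ZMod N) * hri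
  have e₂ : ri * (-r' - s') = -(ri * r') - ri * s' := by ring
  have key : fermatCMType N (ri * r') (ri * s') (ri * (-r' - s')) = fermatCMType N (ri * r) (ri * s) (ri * (-r - s)) := by
    ext x
    rw [mem_fermatCMType_mul_iff_of_isUnit hri', mem_fermatCMType_mul_iff_of_isUnit hri', heq]
  rw [show ri * r = 1 from by rw [mul_comm]; exact hri, e₁, e₂] at key
  have c₂ : (-1 - ri * s : ZMod N).val.Coprime N := by
    rw [← e₁]; exact (isUnit_iff_val_coprime₉ _).1 (hri'.mul ht)
  have c₅ : (-(ri * r') - ri * s' : ZMod N).val.Coprime N := by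
    rw [← e₂]; exact (isUnit_iff_val_coprime₉ _).1 (hri'.mul ht')
  obtain ⟨u, hu⟩ := H (ri * s) (ri * r') (ri * s') ((isUnit_iff_val_coprime₉ _).1 (hri'.mul hs)) c₂
    ((isUnit_iff_val_coprime₉ _).1 (hri'.mul hr')) ((isUnit_iff_val_coprime₉ _).1 (hri'.mul hs')) c₅ key
  have hu' := congrArg (Multiset.map (fun w => r * w)) hu
  rw [map_mul_triple, map_mul_triple, show r * (ri * r') = r' by linear_combination r' * hri,
    show r * (ri * s') = s' by linear_combination s' * hri,
    show r * (-(ri * r') - ri * s') = -r' - s' by linear_combination (-r' - s') * hri, mul_comm r u,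
    show r * (u * (ri * s)) = u * s by linear_combination (u * s) * hri,
    show r * (u * (-1 - ri * s)) = u * (-r - s) by linear_combination (-(u * s)) * hri] at hu'
  have hmem : u * r ∈ ({r', s', -r' - s'} : Multiset (ZMod N)) := by
    rw [hu']
    exact Multiset.mem_cons_self _ _
  simp only [Multiset.insert_eq_cons, Multiset.mem_cons, Multiset.mem_singleton] at hmem
  have hur : IsUnit (u * r) := by
    rcases hmem with h | h | h <;> rw [h]
    exacts [hr', hs', ht']
  exact ⟨u, isUnit_of_mul_isUnit_left hur, hu'⟩

/-- From a normalised Remark-2 statement ("a non-obvious coincidence `H_{r′,s′,−r′−s′} = H_{1,s,−1−s}` forces `s ∈ {ρ₁, ρ₂}`") to all unit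
triples: `H_{τ′} = H_τ` with `{τ′} ≠ {τ}` forces `{r, s, t} = u·{1, ρ₁, ρ₂}` for a unit `u` (here `1 + ρ₁ + ρ₂ = 0`).
[cite: KoblitzRohrlich1978, §1 (p. 1184) and §2 Remark 2 (p. 1193)] -/
private theorem exists_unit_multiset_eq_pair_of_normalised {ρ₁ ρ₂ : ZMod N} (h₁₂ : -1 - ρ₁ = ρ₂) (h₂₁ : -1 - ρ₂ = ρ₁)
    (R : ∀ s r' s' : ZMod N, s.val.Coprime N → (-1 - s : ZMod N).val.Coprime N →
      r'.val.Coprime N → s'.val.Coprime N → (-r' - s' : ZMod N).val.Coprime N →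
      fermatCMType N r' s' (-r' - s') = fermatCMType N 1 s (-1 - s) →
      ({r', s', -r' - s'} : Multiset (ZMod N)) ≠ {1, s, -1 - s} → s = ρ₁ ∨ s = ρ₂)
    {r s t r' s' t' : ZMod N} (hr : IsUnit r) (hs : IsUnit s) (ht : IsUnit t) (hrst : r + s + t = 0)
    (hr' : IsUnit r') (hs' : IsUnit s') (ht' : IsUnit t') (hrst' : r' + s' + t' = 0)
    (heq : fermatCMType N r' s' t' = fermatCMType N r s t) (hne : ({r', s', t'} : Multiset (ZMod N)) ≠ {r, s, t}) :
    ∃ u : ZMod N, IsUnit u ∧ ({r, s, t} : Multiset (ZMod N)) = {u, u * ρ₁, u * ρ₂} := by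
  obtain rfl : t = -r - s := by linear_combination hrst
  obtain rfl : t' = -r' - s' := by linear_combination hrst'
  obtain ⟨ri, hri⟩ := hr.exists_right_inv
  have hri' : IsUnit ri := IsUnit.of_mul_eq_one_right r hri
  have e₁ : ri * (-r - s) = -1 - ri * s := by linear_combination (-1 : ZMod N) * hri
  have e₂ : ri * (-r' - s') = -(ri * r') - ri * s' := by ring
  have key : fermatCMType N (ri * r') (ri * s') (ri * (-r' - s')) = fermatCMType N (ri * r) (ri * s) (ri * (-r - s)) := by
    ext x
    rw [mem_fermatCMType_mul_iff_of_isUnit hri', mem_fermatCMType_mul_iff_of_isUnit hri', heq]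
  rw [show ri * r = 1 from by rw [mul_comm]; exact hri, e₁, e₂] at key
  have c₂ : (-1 - ri * s : ZMod N).val.Coprime N := by
    rw [← e₁]; exact (isUnit_iff_val_coprime₉ _).1 (hri'.mul ht)
  have c₅ : (-(ri * r') - ri * s' : ZMod N).val.Coprime N := by
    rw [← e₂]; exact (isUnit_iff_val_coprime₉ _).1 (hri'.mul ht')
  have hne₁ : ({ri * r', ri * s', -(ri * r') - ri * s'} : Multiset (ZMod N)) ≠ {1, ri * s, -1 - ri * s} := by
    intro h
    apply hne
    have h' := congrArg (Multiset.map (fun w => r * w)) h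
    rwa [map_mul_triple, map_mul_triple, show r * (ri * r') = r' by linear_combination r' * hri,
      show r * (ri * s') = s' by linear_combination s' * hri,
      show r * (-(ri * r') - ri * s') = -r' - s' by linear_combination (-r' - s') * hri, mul_one,
      show r * (ri * s) = s by linear_combination s * hri,
      show r * (-1 - ri * s) = -r - s by linear_combination (-s) * hri] at h'
  refine ⟨r, hr, ?_⟩
  rcases R (ri * s) (ri * r') (ri * s') ((isUnit_iff_val_coprime₉ _).1 (hri'.mul hs)) c₂
      ((isUnit_iff_val_coprime₉ _).1 (hri'.mul hr')) ((isUnit_iff_val_coprime₉ _).1 (hri'.mul hs')) c₅ key hne₁ with h | h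
  · rw [← h₁₂, ← h, show r * (ri * s) = s by linear_combination s * hri,
      show r * (-1 - ri * s) = -r - s by linear_combination (-s) * hri]
  · rw [← h₂₁, ← h, show r * (ri * s) = s by linear_combination s * hri,
      show r * (-1 - ri * s) = -r - s by linear_combination (-s) * hri, Multiset.pair_comm (-r - s) s]

/-- **Theorem 1 (i) in the "`hH_{r,s} = H_{r′,s′}`" reading, from the class form**: if at level `N` every coincidence `H_{τ′} = H_τ` of unit
triples is an equivalence `τ′ ∼ τ`, then `H_{τ′}` is a unit translate `{x | ux ∈ H_τ}` of `H_τ` iff `τ′ ∼ τ` ("If `H_{r,s} = hH_{r′,s′}` for some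
`h` … identical lattices. … suppose … isogenous. Then … `hH_{r,s} = H_{r′,s′}`"). [cite: KoblitzRohrlich1978, §1 (p. 1184) and Theorem 1 (i) (p. 1185)] -/
theorem exists_forall_mem_iff_iff_exists_unit_multiset_eq_of_classForm
    (hC : ∀ r s t r' s' t' : ZMod N, IsUnit r → IsUnit s → IsUnit t → r + s + t = 0 → IsUnit r' → IsUnit s' → IsUnit t' →
      r' + s' + t' = 0 → fermatCMType N r' s' t' = fermatCMType N r s t →
      ∃ u : ZMod N, IsUnit u ∧ ({r', s', t'} : Multiset (ZMod N)) = {u * r, u * s, u * t})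
    {r s t r' s' t' : ZMod N} (hr : IsUnit r) (hs : IsUnit s) (ht : IsUnit t) (hrst : r + s + t = 0)
    (hr' : IsUnit r') (hs' : IsUnit s') (ht' : IsUnit t') (hrst' : r' + s' + t' = 0) :
    (∃ u : ZMod N, IsUnit u ∧ ∀ x, x ∈ fermatCMType N r' s' t' ↔ u * x ∈ fermatCMType N r s t) ↔
      ∃ u : ZMod N, IsUnit u ∧ ({r', s', t'} : Multiset (ZMod N)) = {u * r, u * s, u * t} := by
  constructor
  · rintro ⟨u, huu, h⟩
    have hHeq : fermatCMType N r' s' t' = fermatCMType N (u * r) (u * s) (u * t) := by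
      ext x
      rw [h x, mem_fermatCMType_mul_iff_of_isUnit huu]
    obtain ⟨v, hv, hm⟩ := hC (u * r) (u * s) (u * t) r' s' t' (huu.mul hr) (huu.mul hs) (huu.mul ht)
      (by rw [← mul_add, ← mul_add, hrst, mul_zero]) hr' hs' ht' hrst' hHeq
    refine ⟨v * u, hv.mul huu, ?_⟩
    simpa only [mul_assoc] using hm
  · rintro ⟨u, huu, h⟩
    refine ⟨u, huu, fun x => ?_⟩
    rw [fermatCMType_eq_of_multiset_eq h, mem_fermatCMType_mul_iff_of_isUnit huu]

variable {L : Type} [Field L] [NumberField L] [IsCyclotomicExtension {N} ℚ L]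
  {A A' : AbelianVariety ℂ} {ι : 𝓞 L →+* End A} {θ : L →+* Module.End ℂ (complexBetti A.X 1)}
  {ι' : 𝓞 L →+* End A'} {θ' : L →+* Module.End ℂ (complexBetti A'.X 1)}

/-- **"It is clear that (ii) follows from (i)"** at ANY level `N`, on abelian varieties: if every coincidence `H_{τ′} = H_τ` of unit triples
modulo `N` is an equivalence `τ′ ∼ τ`, then abelian varieties `A`, `A′` of types `Φ_{H_{r,s,t}}`, `Φ_{H_{r′,s′,t′}}` of `ℚ(ζ_N)` (unit triples,
sums `0`) are ISOGENOUS iff `{r′, s′, t′} = {ur, us, ut}` for a unit `u` ("the only isogenies … are the obvious equalities"; the tree's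
any-level `isIsogenous_fermatCMType_iff_exists_unit_translate` — `A ∼ A′ ⟺ H′ = {c | cu ∈ H}` — composed with the class form).
[cite: KoblitzRohrlich1978, Theorem 1 (p. 1185) and §1 (p. 1184)] [cite: Shimura1998, §8.4 Example (1) and §6.1 Corollary] -/
theorem isIsogenous_fermatCMType_iff_exists_unit_multiset_eq_of_classForm [IsCMField L]
    (hC : ∀ r s t r' s' t' : ZMod N, IsUnit r → IsUnit s → IsUnit t → r + s + t = 0 → IsUnit r' → IsUnit s' → IsUnit t' →
      r' + s' + t' = 0 → fermatCMType N r' s' t' = fermatCMType N r s t →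
      ∃ u : ZMod N, IsUnit u ∧ ({r', s', t'} : Multiset (ZMod N)) = {u * r, u * s, u * t})
    {r s t r' s' t' : ZMod N} (hr : IsUnit r) (hs : IsUnit s) (ht : IsUnit t) (hrst : r + s + t = 0)
    (hr' : IsUnit r') (hs' : IsUnit s') (ht' : IsUnit t') (hrst' : r' + s' + t' = 0)
    (hS : IsCMResidueSet N (fermatCMType N r s t)) (hS' : IsCMResidueSet N (fermatCMType N r' s' t'))
    (hA : IsCMTypeRealisation (cmTypeOfResidues (L := L) (fermatCMType N r s t) hS.cm) A ι θ)
    (hA' : IsCMTypeRealisation (cmTypeOfResidues (L := L) (fermatCMType N r' s' t') hS'.cm) A' ι' θ') :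
    AbelianVariety.IsIsogenous A A' ↔
      ∃ u : ZMod N, IsUnit u ∧ ({r', s', t'} : Multiset (ZMod N)) = {u * r, u * s, u * t} := by
  rw [isIsogenous_fermatCMType_iff_exists_unit_translate hS hS' hA hA',
    ← exists_forall_mem_iff_iff_exists_unit_multiset_eq_of_classForm hC hr hs ht hrst hr' hs' ht' hrst']
  constructor
  · rintro ⟨u, hu, h⟩
    have huu : IsUnit u := (mem_unitResidues_iff_isUnit u).1 hu
    exact ⟨u, huu, (forall_mem_unitResidues_iff_forall huu).1 h⟩
  · rintro ⟨u, huu, h⟩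
    exact ⟨u, (mem_unitResidues_iff_isUnit u).2 huu, (forall_mem_unitResidues_iff_forall huu).2 h⟩

end AnyLevel

/-! ## §2 `N = 21`: Theorem 1 (i) in the `∼` form and Theorem 1 (ii) hold; Remark 2's `(1, ρ, ρ²) = (1, 4, 16)` -/

section TwentyOne

/-- **Enumeration at `N = 21`, normalised form**: for units `s, −1−s, r′, s′, −r′−s′` modulo `21`, `H_{r′,s′,−r′−s′} = H_{1,s,−1−s}` implies
`{r′, s′, −r′−s′} = u·{1, s, −1−s}` for some `u` (kernel computation over all `12³` cases).
[cite: KoblitzRohrlich1978, Theorem 1 (i) (p. 1185) and §2 Remark 2 (p. 1193)] -/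
theorem fermatCMType_eq_imp_exists_multiset_eq_twentyOne_normalised :
    ∀ s r' s' : ZMod 21, s.val.Coprime 21 → (-1 - s : ZMod 21).val.Coprime 21 →
      r'.val.Coprime 21 → s'.val.Coprime 21 → (-r' - s' : ZMod 21).val.Coprime 21 →
      fermatCMType 21 r' s' (-r' - s') = fermatCMType 21 1 s (-1 - s) →
      ∃ u : ZMod 21, ({r', s', -r' - s'} : Multiset (ZMod 21)) = {u, u * s, u * (-1 - s)} := by
  decide

/-- **Remark 2 at `N = 21`, normalised form**: a NON-obvious coincidence `H_{r′,s′,−r′−s′} = H_{1,s,−1−s}`, `{r′,s′,−r′−s′} ≠ {1,s,−1−s}`,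
among unit triples forces `s ∈ {4, 16}` ("we can take `(r, s, t)` to be `(1, ρ, ρ²)` where `ρ` is a cube root of `1 mod N`"; kernel
computation). [cite: KoblitzRohrlich1978, §2 Remark 2 (p. 1193)] -/
theorem eq_four_or_eq_sixteen_of_fermatCMType_eq_of_ne_twentyOne :
    ∀ s r' s' : ZMod 21, s.val.Coprime 21 → (-1 - s : ZMod 21).val.Coprime 21 →
      r'.val.Coprime 21 → s'.val.Coprime 21 → (-r' - s' : ZMod 21).val.Coprime 21 →
      fermatCMType 21 r' s' (-r' - s') = fermatCMType 21 1 s (-1 - s) →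
      ({r', s', -r' - s'} : Multiset (ZMod 21)) ≠ {1, s, -1 - s} → s = 4 ∨ s = 16 := by
  decide

/-- The cube roots of `1` modulo `21` are `1`, `4 = ρ` and `16 = ρ²` (kernel computation). [cite: KoblitzRohrlich1978, §2 Remark 2 (p. 1193)] -/
theorem pow_three_eq_one_iff_twentyOne : ∀ x : ZMod 21, x ^ 3 = 1 ↔ x = 1 ∨ x = 4 ∨ x = 16 := by
  decide

/-- **THEOREM 1 (i) in its printed form holds at `N = 21`** (relatively prime case): for unit triples `τ = (r,s,t)`, `τ′ = (r′,s′,t′)`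
modulo `21` (sums `0`), `H_{τ′} = H_τ` implies `{r′, s′, t′} = {ur, us, ut}` for a unit `u` — `τ′ ∼ τ` — although the strong form
`{τ′} = {τ}` fails there (sibling `not_forall_fermatCMType_eq_imp_multiset_eq_twentyOne`).
[cite: KoblitzRohrlich1978, Theorem 1 (i) (p. 1185) and §2 Remark 2 (p. 1193)] -/
theorem exists_unit_multiset_eq_of_fermatCMType_eq_twentyOne {r s t r' s' t' : ZMod 21}
    (hr : IsUnit r) (hs : IsUnit s) (ht : IsUnit t) (hrst : r + s + t = 0)
    (hr' : IsUnit r') (hs' : IsUnit s') (ht' : IsUnit t') (hrst' : r' + s' + t' = 0)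
    (heq : fermatCMType 21 r' s' t' = fermatCMType 21 r s t) :
    ∃ u : ZMod 21, IsUnit u ∧ ({r', s', t'} : Multiset (ZMod 21)) = {u * r, u * s, u * t} :=
  exists_unit_multiset_eq_of_fermatCMType_eq_of_normalised fermatCMType_eq_imp_exists_multiset_eq_twentyOne_normalised hr hs ht
    hrst hr' hs' ht' hrst' heq

/-- **REMARK 2 at `N = 21`** ("the non-obvious isogenies in the relatively prime case all turn out to occur when … we can take `(r, s, t)`
to be `(1, ρ, ρ²)`"): for unit triples modulo `21`, a coincidence `H_{τ′} = H_τ` with `{τ′} ≠ {τ}` forces `{r, s, t} = u·{1, 4, 16}` for a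
unit `u`. [cite: KoblitzRohrlich1978, §2 Remark 2 (p. 1193)] -/
theorem exists_unit_multiset_eq_cubeRoots_of_fermatCMType_eq_of_ne_twentyOne {r s t r' s' t' : ZMod 21}
    (hr : IsUnit r) (hs : IsUnit s) (ht : IsUnit t) (hrst : r + s + t = 0)
    (hr' : IsUnit r') (hs' : IsUnit s') (ht' : IsUnit t') (hrst' : r' + s' + t' = 0)
    (heq : fermatCMType 21 r' s' t' = fermatCMType 21 r s t) (hne : ({r', s', t'} : Multiset (ZMod 21)) ≠ {r, s, t}) :
    ∃ u : ZMod 21, IsUnit u ∧ ({r, s, t} : Multiset (ZMod 21)) = {u, u * 4, u * 16} :=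
  exists_unit_multiset_eq_pair_of_normalised (by decide) (by decide) eq_four_or_eq_sixteen_of_fermatCMType_eq_of_ne_twentyOne
    hr hs ht hrst hr' hs' ht' hrst' heq hne

/-- **Theorem 1 (i) at `21` in the "`hH = H′`" reading**: for unit triples modulo `21`, `H_{τ′}` is a unit translate `{x | ux ∈ H_τ}` iff
`τ′ ∼ τ`. [cite: KoblitzRohrlich1978, §1 (p. 1184) and Theorem 1 (i) (p. 1185)] -/
theorem exists_forall_mem_iff_iff_exists_unit_multiset_eq_twentyOne {r s t r' s' t' : ZMod 21}
    (hr : IsUnit r) (hs : IsUnit s) (ht : IsUnit t) (hrst : r + s + t = 0)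
    (hr' : IsUnit r') (hs' : IsUnit s') (ht' : IsUnit t') (hrst' : r' + s' + t' = 0) :
    (∃ u : ZMod 21, IsUnit u ∧ ∀ x, x ∈ fermatCMType 21 r' s' t' ↔ u * x ∈ fermatCMType 21 r s t) ↔
      ∃ u : ZMod 21, IsUnit u ∧ ({r', s', t'} : Multiset (ZMod 21)) = {u * r, u * s, u * t} :=
  exists_forall_mem_iff_iff_exists_unit_multiset_eq_of_classForm
    (fun _ _ _ _ _ _ hr hs ht hrst hr' hs' ht' hrst' heq =>
      exists_unit_multiset_eq_of_fermatCMType_eq_twentyOne hr hs ht hrst hr' hs' ht' hrst' heq)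
    hr hs ht hrst hr' hs' ht' hrst'

open CategoryTheory
open Literature.AlgebraicGeometry.Motives (AbelianVariety)
open CyclotomicCMTypeResidueSets (IsCMResidueSet)

variable {L : Type} [Field L] [NumberField L] [IsCyclotomicExtension {21} ℚ L]
  {A A' : AbelianVariety ℂ} {ι : 𝓞 L →+* End A} {θ : L →+* Module.End ℂ (complexBetti A.X 1)}
  {ι' : 𝓞 L →+* End A'} {θ' : L →+* Module.End ℂ (complexBetti A'.X 1)}

/-- **THEOREM 1 (ii) HOLDS at the exceptional level `N = 21`** (relatively prime case): abelian varieties `A`, `A′` of types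
`Φ_{H_{r,s,t}}`, `Φ_{H_{r′,s′,t′}}` of `ℚ(ζ₂₁)` (unit triples, sums `0`) are ISOGENOUS iff `{r′, s′, t′} = {ur, us, ut}` for a unit `u` — "the
only isogenies … are the obvious equalities" (Remark 2's `J_{1,4,16} ∼ E⁶` is an isogeny with a power of a LOWER-dimensional factor).
[cite: KoblitzRohrlich1978, Theorem 1 (ii) (p. 1185) and §2 Remark 2 (p. 1193)] [cite: Shimura1998, §8.4 Example (1) and §6.1 Corollary] -/
theorem isIsogenous_fermatCMType_iff_exists_unit_multiset_eq_twentyOne [IsCMField L] {r s t r' s' t' : ZMod 21}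
    (hr : IsUnit r) (hs : IsUnit s) (ht : IsUnit t) (hrst : r + s + t = 0)
    (hr' : IsUnit r') (hs' : IsUnit s') (ht' : IsUnit t') (hrst' : r' + s' + t' = 0)
    (hS : IsCMResidueSet 21 (fermatCMType 21 r s t)) (hS' : IsCMResidueSet 21 (fermatCMType 21 r' s' t'))
    (hA : IsCMTypeRealisation (cmTypeOfResidues (L := L) (fermatCMType 21 r s t) hS.cm) A ι θ)
    (hA' : IsCMTypeRealisation (cmTypeOfResidues (L := L) (fermatCMType 21 r' s' t') hS'.cm) A' ι' θ') :
    AbelianVariety.IsIsogenous A A' ↔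
      ∃ u : ZMod 21, IsUnit u ∧ ({r', s', t'} : Multiset (ZMod 21)) = {u * r, u * s, u * t} :=
  isIsogenous_fermatCMType_iff_exists_unit_multiset_eq_of_classForm
    (fun _ _ _ _ _ _ hr hs ht hrst hr' hs' ht' hrst' heq =>
      exists_unit_multiset_eq_of_fermatCMType_eq_twentyOne hr hs ht hrst hr' hs' ht' hrst' heq)
    hr hs ht hrst hr' hs' ht' hrst' hS hS' hA hA'

end TwentyOne

/-! ## §3 `N = 39`: the same, with `(1, ρ, ρ²) = (1, 16, 22)` -/

section ThirtyNine

set_option maxRecDepth 100000 in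
/-- **Enumeration at `N = 39`, normalised form**: for units `s, −1−s, r′, s′, −r′−s′` modulo `39`, `H_{r′,s′,−r′−s′} = H_{1,s,−1−s}` implies
`{r′, s′, −r′−s′} = u·{1, s, −1−s}` for some `u` (kernel computation over all `24³` cases).
[cite: KoblitzRohrlich1978, Theorem 1 (i) (p. 1185) and §2 Remark 2 (p. 1193)] -/
theorem fermatCMType_eq_imp_exists_multiset_eq_thirtyNine_normalised :
    ∀ s r' s' : ZMod 39, s.val.Coprime 39 → (-1 - s : ZMod 39).val.Coprime 39 →
      r'.val.Coprime 39 → s'.val.Coprime 39 → (-r' - s' : ZMod 39).val.Coprime 39 →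
      fermatCMType 39 r' s' (-r' - s') = fermatCMType 39 1 s (-1 - s) →
      ∃ u : ZMod 39, ({r', s', -r' - s'} : Multiset (ZMod 39)) = {u, u * s, u * (-1 - s)} := by
  decide

set_option maxRecDepth 100000 in
/-- **Remark 2 at `N = 39`, normalised form**: a non-obvious coincidence `H_{r′,s′,−r′−s′} = H_{1,s,−1−s}` among unit triples forces
`s ∈ {16, 22}` (`ρ = 16`, `ρ² = 22`; kernel computation). [cite: KoblitzRohrlich1978, §2 Remark 2 (p. 1193)] -/
theorem eq_sixteen_or_eq_twentyTwo_of_fermatCMType_eq_of_ne_thirtyNine :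
    ∀ s r' s' : ZMod 39, s.val.Coprime 39 → (-1 - s : ZMod 39).val.Coprime 39 →
      r'.val.Coprime 39 → s'.val.Coprime 39 → (-r' - s' : ZMod 39).val.Coprime 39 →
      fermatCMType 39 r' s' (-r' - s') = fermatCMType 39 1 s (-1 - s) →
      ({r', s', -r' - s'} : Multiset (ZMod 39)) ≠ {1, s, -1 - s} → s = 16 ∨ s = 22 := by
  decide

/-- The cube roots of `1` modulo `39` are `1`, `16 = ρ` and `22 = ρ²` (kernel computation). [cite: KoblitzRohrlich1978, §2 Remark 2 (p. 1193)] -/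
theorem pow_three_eq_one_iff_thirtyNine : ∀ x : ZMod 39, x ^ 3 = 1 ↔ x = 1 ∨ x = 16 ∨ x = 22 := by
  decide

/-- **THEOREM 1 (i) in its printed form holds at `N = 39`** (relatively prime case): `H_{τ′} = H_τ` implies `τ′ ∼ τ` for unit triples modulo
`39`, although the strong form fails there (sibling `not_forall_fermatCMType_eq_imp_multiset_eq_thirtyNine`).
[cite: KoblitzRohrlich1978, Theorem 1 (i) (p. 1185) and §2 Remark 2 (p. 1193)] -/
theorem exists_unit_multiset_eq_of_fermatCMType_eq_thirtyNine {r s t r' s' t' : ZMod 39}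
    (hr : IsUnit r) (hs : IsUnit s) (ht : IsUnit t) (hrst : r + s + t = 0)
    (hr' : IsUnit r') (hs' : IsUnit s') (ht' : IsUnit t') (hrst' : r' + s' + t' = 0)
    (heq : fermatCMType 39 r' s' t' = fermatCMType 39 r s t) :
    ∃ u : ZMod 39, IsUnit u ∧ ({r', s', t'} : Multiset (ZMod 39)) = {u * r, u * s, u * t} :=
  exists_unit_multiset_eq_of_fermatCMType_eq_of_normalised fermatCMType_eq_imp_exists_multiset_eq_thirtyNine_normalised hr hs ht
    hrst hr' hs' ht' hrst' heq

/-- **REMARK 2 at `N = 39`**: for unit triples modulo `39`, a coincidence `H_{τ′} = H_τ` with `{τ′} ≠ {τ}` forces `{r, s, t} = u·{1, 16, 22}`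
for a unit `u`. [cite: KoblitzRohrlich1978, §2 Remark 2 (p. 1193)] -/
theorem exists_unit_multiset_eq_cubeRoots_of_fermatCMType_eq_of_ne_thirtyNine {r s t r' s' t' : ZMod 39}
    (hr : IsUnit r) (hs : IsUnit s) (ht : IsUnit t) (hrst : r + s + t = 0)
    (hr' : IsUnit r') (hs' : IsUnit s') (ht' : IsUnit t') (hrst' : r' + s' + t' = 0)
    (heq : fermatCMType 39 r' s' t' = fermatCMType 39 r s t) (hne : ({r', s', t'} : Multiset (ZMod 39)) ≠ {r, s, t}) :
    ∃ u : ZMod 39, IsUnit u ∧ ({r, s, t} : Multiset (ZMod 39)) = {u, u * 16, u * 22} :=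
  exists_unit_multiset_eq_pair_of_normalised (by decide) (by decide) eq_sixteen_or_eq_twentyTwo_of_fermatCMType_eq_of_ne_thirtyNine
    hr hs ht hrst hr' hs' ht' hrst' heq hne

/-- **Theorem 1 (i) at `39` in the "`hH = H′`" reading**: `H_{τ′}` is a unit translate of `H_τ` iff `τ′ ∼ τ`, for unit triples modulo `39`.
[cite: KoblitzRohrlich1978, §1 (p. 1184) and Theorem 1 (i) (p. 1185)] -/
theorem exists_forall_mem_iff_iff_exists_unit_multiset_eq_thirtyNine {r s t r' s' t' : ZMod 39}
    (hr : IsUnit r) (hs : IsUnit s) (ht : IsUnit t) (hrst : r + s + t = 0)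
    (hr' : IsUnit r') (hs' : IsUnit s') (ht' : IsUnit t') (hrst' : r' + s' + t' = 0) :
    (∃ u : ZMod 39, IsUnit u ∧ ∀ x, x ∈ fermatCMType 39 r' s' t' ↔ u * x ∈ fermatCMType 39 r s t) ↔
      ∃ u : ZMod 39, IsUnit u ∧ ({r', s', t'} : Multiset (ZMod 39)) = {u * r, u * s, u * t} :=
  exists_forall_mem_iff_iff_exists_unit_multiset_eq_of_classForm
    (fun _ _ _ _ _ _ hr hs ht hrst hr' hs' ht' hrst' heq =>
      exists_unit_multiset_eq_of_fermatCMType_eq_thirtyNine hr hs ht hrst hr' hs' ht' hrst' heq)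
    hr hs ht hrst hr' hs' ht' hrst'

open CategoryTheory
open Literature.AlgebraicGeometry.Motives (AbelianVariety)
open CyclotomicCMTypeResidueSets (IsCMResidueSet)

variable {L : Type} [Field L] [NumberField L] [IsCyclotomicExtension {39} ℚ L]
  {A A' : AbelianVariety ℂ} {ι : 𝓞 L →+* End A} {θ : L →+* Module.End ℂ (complexBetti A.X 1)}
  {ι' : 𝓞 L →+* End A'} {θ' : L →+* Module.End ℂ (complexBetti A'.X 1)}

/-- **THEOREM 1 (ii) HOLDS at the exceptional level `N = 39`** (relatively prime case): abelian varieties of types `Φ_{H_{r,s,t}}`,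
`Φ_{H_{r′,s′,t′}}` of `ℚ(ζ₃₉)` (unit triples) are isogenous iff `{r′, s′, t′} = {ur, us, ut}` for a unit `u`.
[cite: KoblitzRohrlich1978, Theorem 1 (ii) (p. 1185) and §2 Remark 2 (p. 1193)] [cite: Shimura1998, §8.4 Example (1) and §6.1 Corollary] -/
theorem isIsogenous_fermatCMType_iff_exists_unit_multiset_eq_thirtyNine [IsCMField L] {r s t r' s' t' : ZMod 39}
    (hr : IsUnit r) (hs : IsUnit s) (ht : IsUnit t) (hrst : r + s + t = 0)
    (hr' : IsUnit r') (hs' : IsUnit s') (ht' : IsUnit t') (hrst' : r' + s' + t' = 0)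
    (hS : IsCMResidueSet 39 (fermatCMType 39 r s t)) (hS' : IsCMResidueSet 39 (fermatCMType 39 r' s' t'))
    (hA : IsCMTypeRealisation (cmTypeOfResidues (L := L) (fermatCMType 39 r s t) hS.cm) A ι θ)
    (hA' : IsCMTypeRealisation (cmTypeOfResidues (L := L) (fermatCMType 39 r' s' t') hS'.cm) A' ι' θ') :
    AbelianVariety.IsIsogenous A A' ↔
      ∃ u : ZMod 39, IsUnit u ∧ ({r', s', t'} : Multiset (ZMod 39)) = {u * r, u * s, u * t} :=
  isIsogenous_fermatCMType_iff_exists_unit_multiset_eq_of_classForm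
    (fun _ _ _ _ _ _ hr hs ht hrst hr' hs' ht' hrst' heq =>
      exists_unit_multiset_eq_of_fermatCMType_eq_thirtyNine hr hs ht hrst hr' hs' ht' hrst' heq)
    hr hs ht hrst hr' hs' ht' hrst' hS hS' hA hA'

end ThirtyNine

/-! ## §4 Every odd two-prime level `N = pᵃqᵇ`, no exception: Theorem 1 (i) in the `∼` form and Theorem 1 (ii) -/

section OddTwoPrimeLevel

open CategoryTheory
open Literature.AlgebraicGeometry.Motives (AbelianVariety)
open CyclotomicCMTypeResidueSets (IsCMResidueSet)

variable {p q a b N : ℕ} [hp : Fact p.Prime] [hq : Fact q.Prime] [NeZero N]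

/-- **THEOREM 1 (i), printed form, at EVERY odd two-prime level** `N = pᵃqᵇ` (`p ≠ q` odd primes, `a, b ≥ 1`; relatively prime case): for
unit triples `τ`, `τ′` modulo `N` (sums `0`), `H_{τ′} = H_τ` implies `{r′, s′, t′} = {ur, us, ut}` for a unit `u` (`u = 1` away from
`21`, `39` by the sibling's strong form; enumeration at `21`, `39`).
[cite: KoblitzRohrlich1978, Theorem 1 (i) (p. 1185) and §2 Remark 2 (p. 1193)] -/
theorem exists_unit_multiset_eq_of_fermatCMType_eq_oddTwoPrimeLevel (hp2 : p ≠ 2) (hq2 : q ≠ 2) (hpq : p ≠ q) (ha : a ≠ 0)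
    (hb : b ≠ 0) (hN : N = p ^ a * q ^ b) {r s t r' s' t' : ZMod N}
    (hr : IsUnit r) (hs : IsUnit s) (ht : IsUnit t) (hrst : r + s + t = 0)
    (hr' : IsUnit r') (hs' : IsUnit s') (ht' : IsUnit t') (hrst' : r' + s' + t' = 0)
    (heq : fermatCMType N r' s' t' = fermatCMType N r s t) :
    ∃ u : ZMod N, IsUnit u ∧ ({r', s', t'} : Multiset (ZMod N)) = {u * r, u * s, u * t} := by
  by_cases h21 : N = 21
  · subst h21
    exact exists_unit_multiset_eq_of_fermatCMType_eq_twentyOne hr hs ht hrst hr' hs' ht' hrst' heq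
  by_cases h39 : N = 39
  · subst h39
    exact exists_unit_multiset_eq_of_fermatCMType_eq_thirtyNine hr hs ht hrst hr' hs' ht' hrst' heq
  exact ⟨1, isUnit_one, by simpa only [one_mul] using
    (fermatCMType_eq_iff_multiset_eq_oddTwoPrimes hp2 hq2 hpq ha hb hN h21 h39 hr hs ht hrst hr' hs' ht' hrst').1 heq⟩

/-- **Theorem 1 (i) in the "`hH = H′`" reading at every odd two-prime level**: `H_{τ′}` is a unit translate `{x | ux ∈ H_τ}` of `H_τ` iff
`τ′ ∼ τ`, for unit triples modulo `N = pᵃqᵇ`. [cite: KoblitzRohrlich1978, §1 (p. 1184) and Theorem 1 (i) (p. 1185)] -/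
theorem exists_forall_mem_iff_iff_exists_unit_multiset_eq_oddTwoPrimeLevel (hp2 : p ≠ 2) (hq2 : q ≠ 2) (hpq : p ≠ q) (ha : a ≠ 0)
    (hb : b ≠ 0) (hN : N = p ^ a * q ^ b) {r s t r' s' t' : ZMod N}
    (hr : IsUnit r) (hs : IsUnit s) (ht : IsUnit t) (hrst : r + s + t = 0)
    (hr' : IsUnit r') (hs' : IsUnit s') (ht' : IsUnit t') (hrst' : r' + s' + t' = 0) :
    (∃ u : ZMod N, IsUnit u ∧ ∀ x, x ∈ fermatCMType N r' s' t' ↔ u * x ∈ fermatCMType N r s t) ↔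
      ∃ u : ZMod N, IsUnit u ∧ ({r', s', t'} : Multiset (ZMod N)) = {u * r, u * s, u * t} :=
  exists_forall_mem_iff_iff_exists_unit_multiset_eq_of_classForm
    (fun _ _ _ _ _ _ hr hs ht hrst hr' hs' ht' hrst' heq =>
      exists_unit_multiset_eq_of_fermatCMType_eq_oddTwoPrimeLevel hp2 hq2 hpq ha hb hN hr hs ht hrst hr' hs' ht' hrst' heq)
    hr hs ht hrst hr' hs' ht' hrst'

variable {L : Type} [Field L] [NumberField L] [IsCyclotomicExtension {N} ℚ L]
  {A A' : AbelianVariety ℂ} {ι : 𝓞 L →+* End A} {θ : L →+* Module.End ℂ (complexBetti A.X 1)}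
  {ι' : 𝓞 L →+* End A'} {θ' : L →+* Module.End ℂ (complexBetti A'.X 1)}

/-- **THEOREM 1 (ii) AT EVERY ODD TWO-PRIME LEVEL `N = pᵃqᵇ`, `21` AND `39` INCLUDED** ("there can be no non-obvious isogenies between
`J_{r,s,t}` and `J_{r′,s′,t′}` if `r, s, t, r′, s′, t′` are all prime to `N`"): for unit triples modulo `N` (sums `0`), abelian varieties of
types `Φ_{H_{r,s,t}}`, `Φ_{H_{r′,s′,t′}}` of `ℚ(ζ_N)` are isogenous iff `{r′, s′, t′} = {ur, us, ut}` for a unit `u` — the sibling's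
`isIsogenous_fermatCMType_iff_exists_multiset_eq_oddTwoPrimes` without the hypotheses `N ≠ 21`, `N ≠ 39`.
[cite: KoblitzRohrlich1978, Theorem 1 (ii) (p. 1185) and §2 Remark 2 (p. 1193)] [cite: Shimura1998, §8.4 Example (1) and §6.1 Corollary] -/
theorem isIsogenous_fermatCMType_iff_exists_unit_multiset_eq_oddTwoPrimeLevel [IsCMField L] (hp2 : p ≠ 2) (hq2 : q ≠ 2)
    (hpq : p ≠ q) (ha : a ≠ 0) (hb : b ≠ 0) (hN : N = p ^ a * q ^ b) {r s t r' s' t' : ZMod N}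
    (hr : IsUnit r) (hs : IsUnit s) (ht : IsUnit t) (hrst : r + s + t = 0)
    (hr' : IsUnit r') (hs' : IsUnit s') (ht' : IsUnit t') (hrst' : r' + s' + t' = 0)
    (hS : IsCMResidueSet N (fermatCMType N r s t)) (hS' : IsCMResidueSet N (fermatCMType N r' s' t'))
    (hA : IsCMTypeRealisation (cmTypeOfResidues (L := L) (fermatCMType N r s t) hS.cm) A ι θ)
    (hA' : IsCMTypeRealisation (cmTypeOfResidues (L := L) (fermatCMType N r' s' t') hS'.cm) A' ι' θ') :
    AbelianVariety.IsIsogenous A A' ↔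
      ∃ u : ZMod N, IsUnit u ∧ ({r', s', t'} : Multiset (ZMod N)) = {u * r, u * s, u * t} :=
  isIsogenous_fermatCMType_iff_exists_unit_multiset_eq_of_classForm
    (fun _ _ _ _ _ _ hr hs ht hrst hr' hs' ht' hrst' heq =>
      exists_unit_multiset_eq_of_fermatCMType_eq_oddTwoPrimeLevel hp2 hq2 hpq ha hb hN hr hs ht hrst hr' hs' ht' hrst' heq)
    hr hs ht hrst hr' hs' ht' hrst' hS hS' hA hA'

end OddTwoPrimeLevel

end CyclotomicFermatCMType

end Literature.AlgebraicGeometry.ComplexMultiplication
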